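import Mathlib
import Summits.ValiantsHypothesis.ValiantsHypothesis.Theorems.DivisionGapTriangularDimersDivisionEasyOddJoinDefs

/-!
# Crux `DivisionGap.TriangularDimersDivisionEasy` (stmt-ValiantsHypothesis-5067), line `Sketch` —
registered stubs `stub_oddJoinWeights` and `stub_faceCoeffLow`

The first half of the FACE IDENTITY for the odd-join polynomial
`oddJoin n = Σ_{J ∈ oddCovers n} (Π_{e ∈ J} y_e) · Π_{e ∈ edges n \ J} (1 + y_e)`
(`y_e = x_e · x_(e.swap)`):

* `stub_oddJoinWeights` — every monomial of `oddJoin n` has total degree `≥ n²`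
  (weight function constantly `1` = total degree);
* `stub_faceCoeffLow` — its degree-`n²` homogeneous component is `Σ_J Π_{e ∈ J} y_e` over the
  PERFECT MATCHINGS `J ⊆ edges n` (edge sets with all degrees exactly `1`).

## Proof

* Handshake: for `J ⊆ edges n`, `Σ_v deg J v = 2 |J|` (a forward edge has two distinct
  endpoints; double counting).  If all degrees are odd they are `≥ 1`, so `n² = #V ≤ 2 |J|`;
  given moreover `2 |J| = n²`, the degrees (all `≥ 1`, summing to `#V`) are all `= 1`, and
  conversely; so `{J ∈ oddCovers n | 2 |J| = n²}` is the set of perfect matchings.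
* Expansion: `Π_{e ∈ s} (1 + y_e) = Σ_{T ⊆ s} Π_{e ∈ T} y_e` (`Finset.prod_one_add`), so
  `oddJoin n` is a sum over pairs `(J, T)`, `T ⊆ edges n \ J`, of the products `y^J · y^T`, each
  weighted homogeneous of weight `2 |J| + 2 |T|` (`IsWeightedHomogeneous.prod`/`.mul`).
* Hence the weight-`d` component of `oddJoin n` is the sub-sum over the pairs with
  `2 |J| + 2 |T| = d` (`weightedHomogeneousComponent_of_mem`): empty for `d < n²`, which gives
  `stub_oddJoinWeights` through `coeff_weightedHomogeneousComponent`, and for `d = n²` exactly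
  the pairs `(J, ∅)` with `J` a perfect matching, which gives `stub_faceCoeffLow`.  Odd `n` needs
  no special treatment (all index sets are then empty automatically).
-/

-- `Summit.ValiantsHypothesis.ValiantsHypothesis.…` is the tree's mandated single-conjunct layout (Sub = Summit).
set_option linter.dupNamespace false

namespace Summit.ValiantsHypothesis.ValiantsHypothesis.Theorems.TriangularDimersDivisionEasy.OddJoin

open scoped BigOperators NNReal
open Finset MvPolynomial

noncomputable section

namespace FaceLow
/-! ### Helper lemmas for `stub_oddJoinWeights` / `stub_faceCoeffLow` (this file's private namespace) -/

/-! #### Combinatorics of degrees -/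

/-- A forward edge has two distinct endpoints. [folklore] -/
theorem fst_ne_snd_of_mem_edges {n : ℕ} {e : Var n} (he : e ∈ edges n) : e.1 ≠ e.2 := by
  unfold edges at he
  have h : IsFwd e := (mem_filter.mp he).2
  intro heq
  have h1 : (e.1.1 : ℕ) = e.2.1 := by rw [heq]
  have h2 : (e.1.2 : ℕ) = e.2.2 := by rw [heq]
  unfold IsFwd at h
  omega

/-- Handshake lemma: the degrees of a loopless edge set sum to twice its size. [folklore] -/
theorem sum_deg_eq {n : ℕ} (J : Finset (Var n)) (hJ : ∀ e ∈ J, e.1 ≠ e.2) :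
    ∑ v, deg J v = 2 * J.card := by
  unfold deg
  simp_rw [card_filter]
  rw [sum_comm, mul_comm, ← smul_eq_mul, ← sum_const]
  refine sum_congr rfl fun e he => ?_
  rw [sum_boole, Nat.cast_id]
  have hpair : (univ.filter fun v : Vtx n => e.1 = v ∨ e.2 = v) = {e.1, e.2} := by
    ext v
    simp only [mem_filter, mem_univ, true_and, mem_insert, mem_singleton]
    constructor <;> rintro (h | h) <;> subst h <;> simp
  rw [hpair, card_pair (hJ e he)]

/-- An odd cover has at least `n² / 2` edges: `n² ≤ 2 |J|`. [folklore] -/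
theorem sq_le_two_mul_card {n : ℕ} {J : Finset (Var n)} (hJ : J ∈ oddCovers n) :
    n * n ≤ 2 * J.card := by
  unfold oddCovers at hJ
  obtain ⟨hsub, hodd⟩ := mem_filter.mp hJ
  rw [mem_powerset] at hsub
  rw [← sum_deg_eq J fun e he => fst_ne_snd_of_mem_edges (hsub he)]
  calc n * n = ∑ _v : Vtx n, (1 : ℕ) := by simp
    _ ≤ ∑ v, deg J v := sum_le_sum fun v _ => (hodd v).pos

/-- The odd covers with exactly `n² / 2` edges are the perfect matchings (edge sets with all
degrees `1`). [folklore] -/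
theorem filter_oddCovers_eq (n : ℕ) :
    (oddCovers n).filter (fun J => 2 * J.card = n * n) =
      (edges n).powerset.filter (fun J => ∀ v : Vtx n, deg J v = 1) := by
  ext J
  simp only [oddCovers, mem_filter, mem_powerset, and_assoc]
  constructor
  · rintro ⟨hsub, hodd, hcard⟩
    refine ⟨hsub, ?_⟩
    have hsum := sum_deg_eq J fun e he => fst_ne_snd_of_mem_edges (hsub he)
    have hle : ∀ v ∈ (univ : Finset (Vtx n)), 1 ≤ deg J v := fun v _ => (hodd v).pos
    have heq : ∑ _v : Vtx n, (1 : ℕ) = ∑ v, deg J v := by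
      rw [hsum, hcard]; simp
    intro v
    exact ((sum_eq_sum_iff_of_le hle).mp heq v (mem_univ v)).symm
  · rintro ⟨hsub, hdeg⟩
    have hsum := sum_deg_eq J fun e he => fst_ne_snd_of_mem_edges (hsub he)
    refine ⟨hsub, fun v => ?_, ?_⟩
    · rw [hdeg v]; exact odd_one
    · simp only [hdeg] at hsum
      simpa using hsum.symm

/-! #### Homogeneous components of the expanded odd-join polynomial -/

/-- `Π_{e ∈ S} y_e` is homogeneous of total degree `2 |S|`. [folklore] -/
theorem isWeightedHomogeneous_prod_yv {n : ℕ} (S : Finset (Var n)) :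
    IsWeightedHomogeneous (fun _ => (1 : ℕ)) (∏ e ∈ S, yv e) (2 * S.card) := by
  have h := IsWeightedHomogeneous.prod S yv (fun _ => 2) fun e _ =>
    (isWeightedHomogeneous_X ℝ≥0 (fun _ : Var n => (1 : ℕ)) e).mul
      (isWeightedHomogeneous_X ℝ≥0 (fun _ : Var n => (1 : ℕ)) e.swap)
  simpa only [sum_const, smul_eq_mul, mul_comm] using h

/-- The weight-`d` component of `y^J · y^T` is the whole term if `d = 2 |J| + 2 |T|` and `0`
otherwise. [folklore] -/
theorem whc_prod_yv_mul {n : ℕ} (J T : Finset (Var n)) (d : ℕ) :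
    weightedHomogeneousComponent (fun _ => (1 : ℕ)) d ((∏ e ∈ J, yv e) * ∏ e ∈ T, yv e) =
      if 2 * J.card + 2 * T.card = d then (∏ e ∈ J, yv e) * ∏ e ∈ T, yv e else 0 := by
  rw [weightedHomogeneousComponent_of_mem
    ((isWeightedHomogeneous_prod_yv J).mul (isWeightedHomogeneous_prod_yv T))]
  by_cases h : 2 * J.card + 2 * T.card = d
  · rw [if_pos h, if_pos h.symm]
  · rw [if_neg h, if_neg (Ne.symm h)]

/-- `oddJoin n` expanded with `Π_{e ∈ s} (1 + y_e) = Σ_{T ⊆ s} y^T`. [folklore] -/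
theorem oddJoin_expand (n : ℕ) : oddJoin n =
    ∑ J ∈ oddCovers n, ∑ T ∈ (edges n \ J).powerset, (∏ e ∈ J, yv e) * ∏ e ∈ T, yv e := by
  unfold oddJoin
  refine sum_congr rfl fun J _ => ?_
  rw [prod_one_add, mul_sum]

/-- The weight-`d` component of `oddJoin n`, term by term. [folklore] -/
theorem whc_oddJoin (n d : ℕ) :
    weightedHomogeneousComponent (fun _ => (1 : ℕ)) d (oddJoin n) =
      ∑ J ∈ oddCovers n, ∑ T ∈ (edges n \ J).powerset,
        if 2 * J.card + 2 * T.card = d then (∏ e ∈ J, yv e) * ∏ e ∈ T, yv e else 0 := by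
  rw [oddJoin_expand, map_sum]
  refine sum_congr rfl fun J _ => ?_
  rw [map_sum]
  exact sum_congr rfl fun T _ => whc_prod_yv_mul J T d

/-- Below total degree `n²` the odd-join polynomial has no homogeneous component. [folklore] -/
theorem whc_oddJoin_eq_zero {n d : ℕ} (hd : d < n * n) :
    weightedHomogeneousComponent (fun _ => (1 : ℕ)) d (oddJoin n) = 0 := by
  rw [whc_oddJoin]
  refine sum_eq_zero fun J hJ => sum_eq_zero fun T _ => ?_
  have hJ' := sq_le_two_mul_card hJ
  rw [if_neg (by omega)]

end FaceLow

open FaceLow in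
/-- Registered stub `stub_oddJoinWeights`: every monomial of `oddJoin n` has total degree at
least `n²`. [folklore] -/
theorem stub_oddJoinWeights (n : ℕ) :
    ∀ m ∈ (oddJoin n).support, n * n ≤ Finsupp.weight (fun _ => (1 : ℕ)) m := by
  intro m hm
  by_contra hlt
  rw [not_le] at hlt
  rw [mem_support_iff] at hm
  apply hm
  have h := coeff_weightedHomogeneousComponent (w := fun _ => (1 : ℕ))
    (Finsupp.weight (fun _ => (1 : ℕ)) m) (oddJoin n) m
  rw [whc_oddJoin_eq_zero hlt, coeff_zero, if_pos rfl] at h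
  exact h.symm

open FaceLow in
/-- Registered stub `stub_faceCoeffLow`: the degree-`n²` component of `oddJoin n` is the
perfect-matching sum `Σ_J y^J`. [folklore] -/
theorem stub_faceCoeffLow (n : ℕ) :
    weightedHomogeneousComponent (fun _ => (1 : ℕ)) (n * n) (oddJoin n) =
      ∑ J ∈ (edges n).powerset.filter (fun J => ∀ v : Vtx n, deg J v = 1), ∏ e ∈ J, yv e := by
  rw [whc_oddJoin, ← filter_oddCovers_eq, sum_filter]
  refine sum_congr rfl fun J hJ => ?_
  have hJ' := sq_le_two_mul_card hJ
  rw [sum_eq_single_of_mem ∅ (empty_mem_powerset _) fun T _ hT => ?_]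
  · simp only [card_empty, mul_zero, add_zero, prod_empty, mul_one]
  · have hT' := card_pos.mpr (nonempty_iff_ne_empty.mpr hT)
    rw [if_neg (by omega)]

end

end Summit.ValiantsHypothesis.ValiantsHypothesis.Theorems.TriangularDimersDivisionEasy.OddJoin
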